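import Mathlib.Analysis.Calculus.ContDiff.Convolution
import Mathlib.Analysis.InnerProductSpace.PiL2
import Mathlib.MeasureTheory.Integral.Bochner.ContinuousLinearMap
import Mathlib.MeasureTheory.Measure.Haar.InnerProductSpace
import Mathlib.MeasureTheory.Measure.Haar.Unique
import Mathlib.LinearAlgebra.Trace
import Literature.MathematicalPhysics.StatisticalMechanics.FccTexturedSet
import HarnessLib

/-!
# The anisotropic isoperimetric inequality, II: mollification does not increase the
# `K`-perimeter

Topic `Literature/Analysis/Convexity`; second file of the series `AnisotropicIsoperimetric*.lean`
(the Wulff inequality for the distributional `K`-perimeter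
`P_K(G) = sup {∫_G div η : η ∈ C¹_c(ℝⁿ; ℝⁿ), η(x) ∈ K}` of
`Literature/MathematicalPhysics/StatisticalMechanics/FccTexturedSet.lean` (`fieldDivergence`) and
of the venture `Summits/Ventures/Crystal3D` (crux `PolycrystalWulffBound`)).

The step formalised here is the standard one of Evans–Gariepy, Thm 5.3 (ii) ("mollification does
not increase the variation": `∫ |D(f * η_ε)| ≤ |Df|`), in the anisotropic form needed later and
for the indicator `χ_G` of a set `G` of finite volume: with an even mollifier `ρ ∈ C¹_c`, `ρ ≥ 0`,
`∫ ρ = 1`, and `u = ρ * χ_G`, for every bounded measurable compactly supported selection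
`k : ℝⁿ → K` one has the ADJOINTNESS IDENTITY
`∫ Du(x)[k(x)] dx = -∫_G div(ρ * k)` (`integral_fderiv_convolution_indicator_apply`), and `ρ * k`
is an admissible field (`C¹`, compactly supported, `K`-valued when `K` is closed convex — an
average of points of `K`; part IIb, `AnisotropicIsoperimetricMollifierBound.lean`). Consequently
every finite maximum `max_{z ∈ F} (-Du(x)[z])`, `F ⊆ K` finite with `0 ∈ F`, integrates to at most
`P_K(G)` (part IIb): the finite-net form of `∫ h_K(-∇u) ≤ P_K(G)` used by the Wulff-inequality
assembly. This part IIa carries the calculus: directional derivatives and divergence of a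
mollification, the Fubini adjointness `∫ (ψ * χ) g = ∫ χ (ψ̌ * g)`, and the identity itself.

All statements are on `EuclideanSpace ℝ (Fin n)` with Lebesgue measure; the `K`-perimeter is
written out as the `iSup` (no definition is introduced).

## References
* L. C. Evans, R. F. Gariepy, *Measure Theory and Fine Properties of Functions*, revised ed.
  (CRC 2015), §5.2.1 Thm 5.2 and §5.2.2 Thm 5.3 (lower semicontinuity; approximation by smooth
  functions, step (ii): mollification and the variation). [`EvansGariepy2015`]
-/

noncomputable section

open Set Filter Function
open _root_.MeasureTheory _root_.MeasureTheory.Measure ContinuousLinearMap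
open scoped ENNReal NNReal Topology Convolution InnerProductSpace

namespace Literature.Analysis.Convexity

open Literature.MathematicalPhysics.StatisticalMechanics (fieldDivergence)

variable {n : ℕ}

/-! ### Directional derivatives of a mollification -/

/-- Directional derivative of a mollification: for `ρ ∈ C¹_c` and locally integrable `g`,
`D(ρ * g)(x)[w] = ((∂_w ρ) * g)(x)` (differentiation under the integral, Evans–Gariepy's
`D(f * η_ε) = Dη_ε * f`). [cite: EvansGariepy2015, §5.2.2 Thm 5.3 (proof, step 1)] -/
theorem fderiv_convolution_apply_eq {ρ : EuclideanSpace ℝ (Fin n) → ℝ} (hρ : ContDiff ℝ 1 ρ)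
    (hcρ : HasCompactSupport ρ) {g : EuclideanSpace ℝ (Fin n) → ℝ}
    (hg : LocallyIntegrable g volume) (x w : EuclideanSpace ℝ (Fin n)) :
    fderiv ℝ (ρ ⋆[lsmul ℝ ℝ, volume] g) x w =
      ((fun t => fderiv ℝ ρ t w) ⋆[lsmul ℝ ℝ, volume] g) x := by
  have h := hcρ.hasFDerivAt_convolution_left (lsmul ℝ ℝ) hρ hg x
  rw [h.fderiv, convolution_def, ContinuousLinearMap.integral_apply, convolution_def]
  · simp only [precompL_apply, lsmul_apply, smul_eq_mul]
  · exact (hcρ.fderiv ℝ).convolutionExists_left _ (hρ.continuous_fderiv one_ne_zero) hg x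

/-- Directional derivative of a vector-valued mollification `ρ * k` (`k : ℝⁿ → ℝⁿ` locally
integrable), coordinatewise: `(D(ρ * k)(y)[w])_i = ((∂_w ρ) * k_i)(y)`.
[cite: EvansGariepy2015, §5.2.2 Thm 5.3 (proof, step 1)] -/
theorem fderiv_convolution_vec_apply_apply {ρ : EuclideanSpace ℝ (Fin n) → ℝ}
    (hρ : ContDiff ℝ 1 ρ) (hcρ : HasCompactSupport ρ)
    {k : EuclideanSpace ℝ (Fin n) → EuclideanSpace ℝ (Fin n)} (hk : LocallyIntegrable k volume)
    (y w : EuclideanSpace ℝ (Fin n)) (i : Fin n) :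
    fderiv ℝ (ρ ⋆[lsmul ℝ ℝ, volume] k) y w i =
      ((fun t => fderiv ℝ ρ t w) ⋆[lsmul ℝ ℝ, volume] (fun x => k x i)) y := by
  have h := hcρ.hasFDerivAt_convolution_left (lsmul ℝ ℝ) hρ hk y
  have hint : Integrable
      (fun t => precompL (EuclideanSpace ℝ (Fin n)) (lsmul ℝ ℝ) (fderiv ℝ ρ t) (k (y - t)))
      volume :=
    (hcρ.fderiv ℝ).convolutionExists_left _ (hρ.continuous_fderiv one_ne_zero) hk y
  -- evaluate at `w`, then take the `i`-th coordinate: a continuous linear functional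
  let Λ : (EuclideanSpace ℝ (Fin n) →L[ℝ] EuclideanSpace ℝ (Fin n)) →L[ℝ] ℝ :=
    (EuclideanSpace.proj i).comp
      (ContinuousLinearMap.apply ℝ (EuclideanSpace ℝ (Fin n)) w)
  have hΛ : ∀ A : EuclideanSpace ℝ (Fin n) →L[ℝ] EuclideanSpace ℝ (Fin n), Λ A = A w i :=
    fun A => rfl
  rw [h.fderiv, convolution_def, ← hΛ, ← Λ.integral_comp_comm hint, convolution_def]
  congr 1

/-! ### The trace on `ℝⁿ` and the divergence of a mollified field -/

/-- `tr L = Σ_i (L e_i)_i` on `EuclideanSpace ℝ (Fin n)` (matrix trace in the standard basis).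
[folklore] -/
private theorem trace_eq_sum_apply_single
    (L : EuclideanSpace ℝ (Fin n) →L[ℝ] EuclideanSpace ℝ (Fin n)) :
    LinearMap.trace ℝ _ (L : EuclideanSpace ℝ (Fin n) →ₗ[ℝ] EuclideanSpace ℝ (Fin n)) =
      ∑ i, L (EuclideanSpace.single i 1) i := by
  classical
  rw [LinearMap.trace_eq_matrix_trace ℝ (EuclideanSpace.basisFun (Fin n) ℝ).toBasis]
  simp [Matrix.trace, Matrix.diag, LinearMap.toMatrix_apply, EuclideanSpace.basisFun_apply]

/-- Divergence of a mollified field, coordinatewise: `div(ρ * k)(y) = Σ_i ((∂_i ρ) * k_i)(y)`.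
[cite: EvansGariepy2015, §5.2.2 Thm 5.3 (proof, step 1)] -/
theorem fieldDivergence_convolution_eq_sum {ρ : EuclideanSpace ℝ (Fin n) → ℝ}
    (hρ : ContDiff ℝ 1 ρ) (hcρ : HasCompactSupport ρ)
    {k : EuclideanSpace ℝ (Fin n) → EuclideanSpace ℝ (Fin n)} (hk : LocallyIntegrable k volume)
    (y : EuclideanSpace ℝ (Fin n)) :
    fieldDivergence (ρ ⋆[lsmul ℝ ℝ, volume] k) y =
      ∑ i, ((fun t => fderiv ℝ ρ t (EuclideanSpace.single i 1)) ⋆[lsmul ℝ ℝ, volume]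
        (fun x => k x i)) y := by
  unfold fieldDivergence
  rw [trace_eq_sum_apply_single]
  exact Finset.sum_congr rfl fun i _ => fderiv_convolution_vec_apply_apply hρ hcρ hk y _ i

/-! ### Adjointness of convolution against a reflected kernel -/

/-- **Adjointness**: for `ψ ∈ C_c`, `χ` integrable and `g` bounded measurable,
`∫ (ψ * χ)(x) g(x) dx = ∫ χ(y) (ψ̌ * g)(y) dy` with `ψ̌(s) = ψ(-s)` (Fubini on
`(x, y) ↦ ψ(x - y) χ(y) g(x)`). [cite: EvansGariepy2015, §5.2.2 Thm 5.3 (proof of (ii))] -/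
theorem integral_convolution_mul_eq_integral_mul_convolution_reflect
    {ψ χ g : EuclideanSpace ℝ (Fin n) → ℝ} (hψ : Continuous ψ) (hcψ : HasCompactSupport ψ)
    (hχ : Integrable χ volume) (hgm : AEStronglyMeasurable g volume) {C : ℝ}
    (hgC : ∀ x, ‖g x‖ ≤ C) :
    ∫ x, (ψ ⋆[lsmul ℝ ℝ, volume] χ) x * g x =
      ∫ y, χ y * ((fun s => ψ (-s)) ⋆[lsmul ℝ ℝ, volume] g) y := by
  have hψi : Integrable ψ volume := hψ.integrable_of_hasCompactSupport hcψ
  -- the Fubini integrand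
  have hF : Integrable (fun p : EuclideanSpace ℝ (Fin n) × EuclideanSpace ℝ (Fin n) =>
      (χ p.2 * ψ (p.1 - p.2)) * g p.1) (volume.prod volume) := by
    have h1 : Integrable (fun p : EuclideanSpace ℝ (Fin n) × EuclideanSpace ℝ (Fin n) =>
        lsmul ℝ ℝ (χ p.2) (ψ (p.1 - p.2))) (volume.prod volume) :=
      hχ.convolution_integrand (lsmul ℝ ℝ) hψi
    simp only [lsmul_apply, smul_eq_mul] at h1
    refine h1.bdd_mul (c := C) (hgm.comp_quasiMeasurePreserving
      (Measure.quasiMeasurePreserving_fst)) (Eventually.of_forall fun p => hgC p.1) |>.congr ?_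
    exact Eventually.of_forall fun p => by simp only [Function.comp_apply]; ring
  calc ∫ x, (ψ ⋆[lsmul ℝ ℝ, volume] χ) x * g x
      = ∫ x, ∫ y, (χ y * ψ (x - y)) * g x := by
        refine integral_congr_ae (Eventually.of_forall fun x => ?_)
        simp only [convolution_eq_swap, lsmul_apply, smul_eq_mul, ← integral_mul_const]
        refine integral_congr_ae (Eventually.of_forall fun y => ?_); ring
    _ = ∫ y, ∫ x, (χ y * ψ (x - y)) * g x := integral_integral_swap hF
    _ = ∫ y, χ y * ((fun s => ψ (-s)) ⋆[lsmul ℝ ℝ, volume] g) y := by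
        refine integral_congr_ae (Eventually.of_forall fun y => ?_)
        simp only [convolution_eq_swap, lsmul_apply, smul_eq_mul, neg_sub, mul_assoc]
        rw [integral_const_mul]


/-! ### Even kernels have odd derivatives -/

/-- The derivative of an even `C¹` function is odd: `Dρ(-x)[w] = -Dρ(x)[w]`. [folklore] -/
private theorem fderiv_neg_apply_of_even {ρ : EuclideanSpace ℝ (Fin n) → ℝ}
    (hρ : ContDiff ℝ 1 ρ) (hρe : ∀ x, ρ (-x) = ρ x) (x w : EuclideanSpace ℝ (Fin n)) :
    fderiv ℝ ρ (-x) w = -fderiv ℝ ρ x w := by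
  have hd : Differentiable ℝ ρ := hρ.differentiable one_ne_zero
  have hneg : HasFDerivAt (fun y : EuclideanSpace ℝ (Fin n) => -y)
      (-(ContinuousLinearMap.id ℝ (EuclideanSpace ℝ (Fin n)))) x := (hasFDerivAt_id x).neg
  have h1 : HasFDerivAt (fun y => ρ (-y))
      ((fderiv ℝ ρ (-x)).comp (-(ContinuousLinearMap.id ℝ (EuclideanSpace ℝ (Fin n))))) x :=
    (hd (-x)).hasFDerivAt.comp x hneg
  have h2 : (fun y => ρ (-y)) = ρ := funext hρe
  rw [h2] at h1
  rw [h1.fderiv]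
  simp

/-! ### The adjointness identity for the mollified indicator -/

/-- Convolution with a reflected odd kernel: `((s ↦ ψ(-s)) * g) = -(ψ * g)` when `ψ` is odd.
[folklore] -/
private theorem convolution_reflect_of_odd {ψ g : EuclideanSpace ℝ (Fin n) → ℝ}
    (hodd : ∀ s, ψ (-s) = -ψ s) (y : EuclideanSpace ℝ (Fin n)) :
    ((fun s => ψ (-s)) ⋆[lsmul ℝ ℝ, volume] g) y = -(ψ ⋆[lsmul ℝ ℝ, volume] g) y := by
  simp only [convolution_def, lsmul_apply, smul_eq_mul, hodd, neg_mul, integral_neg]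

/-- A convolution `ψ * g` of `ψ ∈ C_c` with a bounded function is bounded by `‖ψ‖₁ · C`.
[folklore] -/
private theorem norm_convolution_le_of_bound {ψ g : EuclideanSpace ℝ (Fin n) → ℝ}
    (hψi : Integrable ψ volume) {C : ℝ} (hgC : ∀ x, ‖g x‖ ≤ C) (y : EuclideanSpace ℝ (Fin n)) :
    ‖(ψ ⋆[lsmul ℝ ℝ, volume] g) y‖ ≤ (∫ t, ‖ψ t‖) * C := by
  rw [convolution_def]
  have hC : 0 ≤ C := (norm_nonneg _).trans (hgC 0)
  calc ‖∫ t, lsmul ℝ ℝ (ψ t) (g (y - t))‖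
      ≤ ∫ t, ‖ψ t‖ * C := by
        refine norm_integral_le_of_norm_le (hψi.norm.mul_const C)
          (Eventually.of_forall fun t => ?_)
        simp only [lsmul_apply, smul_eq_mul, norm_mul]
        exact mul_le_mul_of_nonneg_left (hgC _) (norm_nonneg _)
    _ = (∫ t, ‖ψ t‖) * C := integral_mul_const _ _

/-- A bounded, a.e.-strongly measurable, compactly supported function is integrable. [folklore] -/
private theorem integrable_of_bound_of_hasCompactSupport {F : Type*} [NormedAddCommGroup F]
    {k : EuclideanSpace ℝ (Fin n) → F} (hkm : AEStronglyMeasurable k volume) {C : ℝ}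
    (hkC : ∀ x, ‖k x‖ ≤ C) (hck : HasCompactSupport k) : Integrable k volume := by
  rw [← integrableOn_iff_integrable_of_support_subset (subset_tsupport k)]
  exact IntegrableOn.of_bound hck.isCompact.measure_lt_top hkm.restrict C
    (Eventually.of_forall hkC)

/-- **Adjointness identity for the mollified indicator.** Let `ρ ∈ C¹_c(ℝⁿ)` be even, `G ⊆ ℝⁿ`
measurable of finite volume, `u = ρ * χ_G`, and `k : ℝⁿ → ℝⁿ` bounded, measurable and compactly
supported. Then `∫ Du(x)[k(x)] dx = -∫_G div(ρ * k)`: the duality behind "mollification does not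
increase the variation" (`∫ u_ε div φ = ∫ u div(η_ε * φ)`).
[cite: EvansGariepy2015, §5.2.2 Thm 5.3 (proof of (ii))] -/
theorem integral_fderiv_convolution_indicator_apply {ρ : EuclideanSpace ℝ (Fin n) → ℝ}
    (hρ : ContDiff ℝ 1 ρ) (hcρ : HasCompactSupport ρ) (hρe : ∀ x, ρ (-x) = ρ x)
    {G : Set (EuclideanSpace ℝ (Fin n))} (hG : MeasurableSet G) (hGfin : volume G < ⊤)
    {k : EuclideanSpace ℝ (Fin n) → EuclideanSpace ℝ (Fin n)} (hkm : AEStronglyMeasurable k volume)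
    {C : ℝ} (hkC : ∀ x, ‖k x‖ ≤ C) (hck : HasCompactSupport k) :
    ∫ x, fderiv ℝ (ρ ⋆[lsmul ℝ ℝ, volume] (G.indicator fun _ => (1 : ℝ))) x (k x) =
      -∫ y in G, fieldDivergence (ρ ⋆[lsmul ℝ ℝ, volume] k) y := by
  set χ : EuclideanSpace ℝ (Fin n) → ℝ := G.indicator fun _ => (1 : ℝ) with hχ_def
  have hχi : Integrable χ volume :=
    (integrable_indicator_iff hG).2 (integrableOn_const hGfin.ne)
  have hχ1 : ∀ x, ‖χ x‖ ≤ 1 := fun x => by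
    rw [hχ_def]; by_cases hx : x ∈ G <;> simp [hx]
  have hki : Integrable k volume := integrable_of_bound_of_hasCompactSupport hkm hkC hck
  -- partial derivatives of the kernel
  set dρ : Fin n → EuclideanSpace ℝ (Fin n) → ℝ :=
    fun i t => fderiv ℝ ρ t (EuclideanSpace.single i 1) with hdρ_def
  have hdρc : ∀ i, Continuous (dρ i) := fun i =>
    (hρ.continuous_fderiv one_ne_zero).clm_apply continuous_const
  have hdρs : ∀ i, HasCompactSupport (dρ i) := fun i => hcρ.fderiv_apply (𝕜 := ℝ) _
  have hdρi : ∀ i, Integrable (dρ i) volume := fun i =>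
    (hdρc i).integrable_of_hasCompactSupport (hdρs i)
  have hdρo : ∀ i s, dρ i (-s) = -dρ i s := fun i s => fderiv_neg_apply_of_even hρ hρe s _
  -- coordinates of `k`
  have hkim : ∀ i, AEStronglyMeasurable (fun x => k x i) volume := fun i =>
    (EuclideanSpace.proj i).continuous.comp_aestronglyMeasurable hkm
  have hkiC : ∀ i x, ‖k x i‖ ≤ C := fun i x => (PiLp.norm_apply_le (k x) i).trans (hkC x)
  have hkii : ∀ i, Integrable (fun x => k x i) volume := fun i =>
    integrable_of_bound_of_hasCompactSupport (hkim i) (hkiC i)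
      (hck.comp_left (g := fun v : EuclideanSpace ℝ (Fin n) => v i) rfl)
  -- Step 1: expand `Du(x)[k(x)]` in coordinates
  have h1 : ∀ x, fderiv ℝ (ρ ⋆[lsmul ℝ ℝ, volume] χ) x (k x) =
      ∑ i, (dρ i ⋆[lsmul ℝ ℝ, volume] χ) x * k x i := by
    intro x
    conv_lhs => rw [← (EuclideanSpace.basisFun (Fin n) ℝ).sum_repr (k x)]
    rw [_root_.map_sum]
    refine Finset.sum_congr rfl fun i _ => ?_
    rw [map_smul, EuclideanSpace.basisFun_apply, EuclideanSpace.basisFun_repr, smul_eq_mul,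
      fderiv_convolution_apply_eq hρ hcρ hχi.locallyIntegrable, mul_comm]
  -- convolutions against the kernel derivatives are bounded and continuous
  have hconv_cont : ∀ i (g : EuclideanSpace ℝ (Fin n) → ℝ), LocallyIntegrable g volume →
      Continuous (dρ i ⋆[lsmul ℝ ℝ, volume] g) := fun i g hg =>
    (hdρs i).continuous_convolution_left _ (hdρc i) hg
  have hint1 : ∀ i, Integrable (fun x => (dρ i ⋆[lsmul ℝ ℝ, volume] χ) x * k x i) volume := by
    intro i
    have := (hkii i).bdd_mul (c := (∫ t, ‖dρ i t‖) * 1)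
      (hconv_cont i χ hχi.locallyIntegrable).aestronglyMeasurable
      (Eventually.of_forall fun x => norm_convolution_le_of_bound (hdρi i) hχ1 x)
    simpa [mul_comm] using this
  rw [integral_congr_ae (Eventually.of_forall h1), integral_finsetSum _ fun i _ => hint1 i]
  -- Step 2: each coordinate through the adjointness identity and oddness of `∂_i ρ`
  have h2 : ∀ i, ∫ x, (dρ i ⋆[lsmul ℝ ℝ, volume] χ) x * k x i =
      -∫ y in G, (dρ i ⋆[lsmul ℝ ℝ, volume] fun x => k x i) y := by
    intro i
    rw [integral_convolution_mul_eq_integral_mul_convolution_reflect (hdρc i) (hdρs i) hχi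
      (hkim i) (hkiC i), ← integral_indicator hG, ← integral_neg]
    refine integral_congr_ae (Eventually.of_forall fun y => ?_)
    dsimp only
    rw [convolution_reflect_of_odd (hdρo i)]
    by_cases hy : y ∈ G <;> simp [hχ_def, hy]
  simp_rw [h2]
  rw [Finset.sum_neg_distrib, ← integral_finsetSum]
  · congr 1
    refine setIntegral_congr_fun hG fun y _ => ?_
    rw [fieldDivergence_convolution_eq_sum hρ hcρ hki.locallyIntegrable]
  · intro i _
    refine IntegrableOn.of_bound hGfin
      (hconv_cont i _ (hkii i).locallyIntegrable).aestronglyMeasurable.restrict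
      ((∫ t, ‖dρ i t‖) * C) (Eventually.of_forall fun y => ?_)
    exact norm_convolution_le_of_bound (hdρi i) (hkiC i) y

end Literature.Analysis.Convexity

end
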